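import Summits.QuantumAdvantage.QuantumAdvantage.Theorems.CubicForrelationNearExactIsExactAmmWalsh
import Summits.QuantumAdvantage.QuantumAdvantage.Theorems.CubicForrelationNearExactIsExactAmmCeilingX
import Summits.QuantumAdvantage.QuantumAdvantage.Theorems.NearExactIsExact.Negative.CornerFlatPolar
import Summits.QuantumAdvantage.QuantumAdvantage.Theorems.NearExactIsExact.Negative.CornerFlatPluecker

/-!
# `NearExactIsExact` (stmt-QuantumAdvantage-14043), negative side — the CORNER-FLAT family:
# forrelation formula, the PARITY LEMMA, and the `15/16` ceiling for non-bent partners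

Negative-side (disprover lane, unit `b2b-cforr-disprove-g33`, 2026-08-23) theorems for the crux
`Summit.QuantumAdvantage.QuantumAdvantage.Theses.CubicForrelation.NearExactIsExact` (`∃ θ < 1`, uniform
isolation of `Φ = 1` among cubic pairs).  HONEST FRAMING: VALUE = THEOREM (a uniform ceiling for one explicit
two-sided family of cubic pairs) — NOT summit progress; the crux is untouched.

**The family.**  The landed almost-Maiorana–McFarland ceiling `stub_ammCeiling` (`…AmmCeiling*.lean`) ends in
the regime (parts Q–V) where, fibre by fibre, `f` restricted to `x₂` is a rank-2 quadratic plus a linear form and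
the four "corners" of the frame lie in the fibre of `g`'s projection.  Here that regime is made SYNTACTIC with a
global frame: for maps `u v w : 𝔽₂^a → 𝔽₂^{a+2}`, `f₀ : 𝔽₂^a → 𝔽₂`, `φ : 𝔽₂^{a+2} → 𝔽₂^a`, `h : 𝔽₂^{a+2} → 𝔽₂`,
* `f(x₁‖x₂) = (u(x₁)·x₂)(v(x₁)·x₂) ⊕ w(x₁)·x₂ ⊕ f₀(x₁)` (`hf`, the dot product supplied by any `l` with
  `(-1)^{l y x} = (-1)^{x·y}`, cf. `fc_linForm_exists`),
* `(-1)^{g(y₁‖y₂)} = (-1)^{y₁·φ(y₂)} (-1)^{h(y₂)}` (`hg`),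
* the corners `corner x₁ στ = w(x₁) ⊕ σu(x₁) ⊕ τv(x₁)` satisfy `φ(corner x₁ στ) = x₁` and are pairwise distinct
  (`hφ`, `hinj`; counting, every fibre of `φ` then IS its set of four corners).
Instances: `u ≡ e_a`, `v ≡ e_{a+1}`, `w(x₁) = (x₁,0,0)`, `φ =` first `a` coordinates gives the Maiorana–McFarland
pairs; non-constant affine frames give genuinely non-MM cubic pairs on both sides (machine-checked cubic at
`a = 4, 5` in the unit's `code/disprove-g33/amm/v1_formula.py`).

**Results.**
* `cf_forrelation_eq` [folklore]: `Φ(f,g) = 2^{-(a+2)} Σ_{x₁} Σ_{στ} (-1)^{h(corner x₁ στ) ⊕ f₀(x₁) ⊕ στ}` — so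
  `Φ = 1 − 2·#{mismatched corners}/2^{a+2}` and the window `(15/16, 1)` needs fewer than `2^{a-3}` mismatches.
* `cf_parity_deg` (PARITY LEMMA, framed; file `…Negative.CornerFlatPolar`) and `cfp_parity_deg` (FRAME-FREE, file
  `…Negative.CornerFlatPluecker`): for cubic `h` the fibre parity `x₁ ↦ ⊕_{στ} h(corner x₁ στ) = D²_{u,v}h(w)` has
  degree `≤ 3` (a priori `6`) as soon as the Plücker coordinates `x₁ ↦ uᵢvⱼ ⊕ uⱼvᵢ` are affine and
  `x₁ ↦ wᵢ ⊕ uᵢvᵢ` is quadratic — exactly what cubicity of `f` forces (`cf_degrees_of_cubic`); no condition on the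
  frame itself (most affine plane fields have no affine frame).  Key identity (`cfp_corner3`):
  `⊕_{στ} Π_{l∈{i,j,k}}(corner)_l = e₂(p_{ij},p_{ik},p_{jk}) ⊕ Σ_l ℓ_l p_{S∖l}`.
* `cf_forrelation_le_fifteen_sixteenths_of_parity` / `cf_forrelation_le_fifteen_sixteenths` (framed) /
  `cf_forrelation_le_fifteen_sixteenths'` (frame-free) / `cf_forrelation_le_fifteen_sixteenths_of_cubic` (hypothesis
  just `f` cubic: the two degree conditions are restricted `x₂`-derivatives of `f`, `acx_deg_polar`, `acx_deg_first`):
  under those hypotheses, ONE fibre of even parity forces `Φ(f,g) ≤ 15/16` (Reed–Muller minimum weight `stub_rmWeight` on the degree-3 parity function: `≥ 2^{a-3}` even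
  fibres, each contributing `≤ 2` instead of `4`, `cf_fibre_sum_le`).  Since the Walsh coefficient of `g` at
  `(x₁,x₂)` is `2^a Σ_{στ} (-1)^{h(corner) ⊕ x₂·corner}` and the four corners sum to `0`, "all fibre parities odd"
  is exactly "`g` is bent": every member of this family inside the window has a BENT cubic partner, the case the
  campaign's THEOREM BENT (HOME `DISPROOF.md`) pushes to `n ≥ 22`.

Mechanism note: of the four mismatch channels `E₀ ⊕ σE₁ ⊕ τE₂ ⊕ στE₃` of a corner-flat pair the `στ`-channel is
killed down to `15/16` here on the whole habitat; `E₁, E₂` have degree `≤ 5`, `E₀` degree `≤ 6` (it contains the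
biquadratic `15/16` witness of `FifteenSixteenths`); see HOME `DISPROOF.md` §41 for the explicit frame families tried.
Everything is a theorem over the standard three axioms; no `decide` on large types, no `native_decide`.
-/

set_option linter.dupNamespace false -- D-0017: single-problem summit ⇒ `QuantumAdvantage.QuantumAdvantage` by design

noncomputable section

namespace Summit.QuantumAdvantage.QuantumAdvantage.Theorems.NearExactIsExact.Negative.CornerFlatParity

open Finset
open Literature.Computability.QuantumComplexity
open Literature.Computability.QuantumComplexity.BuzetChailloux (bxor zeroVec bxor_comm bxor_self zeroVec_bxor
  bxor_zeroVec twist_bxor_right twist_zeroVec_right)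
open Literature.Computability.QuantumComplexity.DerivativeWalsh (W)
open Summit.QuantumAdvantage.QuantumAdvantage.Theorems.CubicForrelation.NearExactIsExact
open Summit.QuantumAdvantage.QuantumAdvantage.Theorems.NearExactIsExact.Negative.CornerFlatPolar
open Summit.QuantumAdvantage.QuantumAdvantage.Theorems.NearExactIsExact.Negative.CornerFlatPluecker (cfp_parity_deg)

variable {a : ℕ}


section Corner

/-! ### The corner map

To keep this file free of definitions, the corner map `corner x₁ (σ, τ) = w(x₁) ⊕ σ·u(x₁) ⊕ τ·v(x₁)` of the
frame `(w; u, v)` is an ARGUMENT `corner` characterised by the hypothesis `hc`. -/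

variable (corner : (Fin a → Bool) → Bool × Bool → (Fin (a + 2) → Bool))
  (w u v : (Fin a → Bool) → (Fin (a + 2) → Bool))
  (hc : ∀ x₁ st j, corner x₁ st j = (w x₁ j ^^ (st.1 && u x₁ j) ^^ (st.2 && v x₁ j))) (x₁ : Fin a → Bool)
include hc

/-- The corner `στ = 00` is the base point `w(x₁)`. -/
theorem corner_ff : corner x₁ (false, false) = w x₁ := by
  funext j; rw [hc]; simp

/-- The corner `στ = 10` is `w(x₁) ⊕ u(x₁)`. -/
theorem corner_tf : corner x₁ (true, false) = bxor (w x₁) (u x₁) := by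
  funext j; rw [hc]; simp [bxor]

/-- The corner `στ = 01` is `w(x₁) ⊕ v(x₁)`. -/
theorem corner_ft : corner x₁ (false, true) = bxor (w x₁) (v x₁) := by
  funext j; rw [hc]; simp [bxor]

/-- The corner `στ = 11` is `w(x₁) ⊕ u(x₁) ⊕ v(x₁)`. -/
theorem corner_tt : corner x₁ (true, true) = bxor (w x₁) (bxor (u x₁) (v x₁)) := by
  funext j; rw [hc]; simp [bxor]

/-- The fibre parity over the four corners is the second derivative `D²_{u,v} h (w)`. -/
theorem cf_corner_parity (h : (Fin (a + 2) → Bool) → Bool) :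
    (h (corner x₁ (false, false)) ^^ h (corner x₁ (true, false)) ^^ h (corner x₁ (false, true)) ^^
      h (corner x₁ (true, true))) = (h (w x₁) ^^ h (bxor (w x₁) (u x₁)) ^^ h (bxor (w x₁) (v x₁)) ^^
        h (bxor (w x₁) (bxor (u x₁) (v x₁)))) := by
  rw [corner_ff corner w u v hc x₁, corner_tf corner w u v hc x₁, corner_ft corner w u v hc x₁,
    corner_tt corner w u v hc x₁]

end Corner

/-- **Forrelation of the corner-flat family.**  If `f(x₁‖x₂) = (u(x₁)·x₂)(v(x₁)·x₂) ⊕ w(x₁)·x₂ ⊕ f₀(x₁)`,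
`(-1)^{g(y₁‖y₂)} = (-1)^{y₁·φ(y₂)} (-1)^{h(y₂)}`, every corner lies in its fibre (`φ(corner x₁ στ) = x₁`) and the four
corners of each `x₁` are distinct, then
`Φ(f,g) = 2^{-(a+2)} Σ_{x₁} Σ_{στ} (-1)^{h(corner x₁ στ) ⊕ f₀(x₁) ⊕ στ}`. [folklore] -/
theorem cf_forrelation_eq (l : (Fin (a + 2) → Bool) → (Fin (a + 2) → Bool) → Bool)
    (hl : ∀ y x, signOf (l y x) = twist x y)
    (u v w : (Fin a → Bool) → (Fin (a + 2) → Bool)) (f₀ : (Fin a → Bool) → Bool)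
    (φ : (Fin (a + 2) → Bool) → (Fin a → Bool)) (h : (Fin (a + 2) → Bool) → Bool)
    (f g : (Fin (a + (a + 2)) → Bool) → Bool)
    (hf : ∀ x₁ x₂, f (Fin.append x₁ x₂) = ((l (u x₁) x₂ && l (v x₁) x₂) ^^ l (w x₁) x₂ ^^ f₀ x₁))
    (hg : ∀ (y₁ : Fin a → Bool) (y₂ : Fin (a + 2) → Bool),
      signOf (g (Fin.append y₁ y₂)) = twist y₁ (φ y₂) * signOf (h y₂))
    (corner : (Fin a → Bool) → Bool × Bool → (Fin (a + 2) → Bool))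
    (hc : ∀ x₁ st j, corner x₁ st j = (w x₁ j ^^ (st.1 && u x₁ j) ^^ (st.2 && v x₁ j)))
    (hφ : ∀ x₁ st, φ (corner x₁ st) = x₁) (hinj : ∀ x₁, Function.Injective (corner x₁)) :
    forrelation f g = ((2 : ℝ) ^ (a + 2))⁻¹ *
      ∑ x₁ : Fin a → Bool, ∑ st : Bool × Bool, signOf (h (corner x₁ st) ^^ f₀ x₁ ^^ (st.1 && st.2)) := by
  classical
  rw [stub_ammWalsh a f g φ h hg]
  -- Walsh value of the aligned slice `f(x₁‖·)` at an arbitrary point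
  have hW : ∀ (x₁ : Fin a → Bool) (y : Fin (a + 2) → Bool),
      ∑ x₂ : Fin (a + 2) → Bool, signOf (f (Fin.append x₁ x₂)) * twist x₂ y =
        (2 : ℝ) ^ (a + 2) / 2 * signOf (f₀ x₁) *
          ((if y = w x₁ then 1 else 0) + (if y = bxor (w x₁) (u x₁) then 1 else 0) +
            (if y = bxor (w x₁) (v x₁) then 1 else 0) - (if y = bxor (w x₁) (bxor (u x₁) (v x₁)) then 1 else 0)) := by
    intro x₁ y
    have key := acq_W_aligned l hl (c := fun x₂ => f (Fin.append x₁ x₂)) (u := u x₁) (v := v x₁) (a := w x₁)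
      (e := f₀ x₁) (fun x₂ => hf x₁ x₂) y
    simpa only [W] using key
  -- the corner parametrisation of `𝔽₂^{a+2}` is a bijection
  have hbij : Function.Bijective (fun p : (Fin a → Bool) × (Bool × Bool) => corner p.1 p.2) := by
    rw [Fintype.bijective_iff_injective_and_card]
    refine ⟨fun p q hpq => ?_, ?_⟩
    · obtain ⟨p1, p2⟩ := p
      obtain ⟨q1, q2⟩ := q
      dsimp only at hpq
      have h1 : p1 = q1 := by rw [← hφ p1 p2, hpq, hφ]
      subst h1
      exact Prod.ext rfl (hinj p1 hpq)
    · simp only [Fintype.card_prod, Fintype.card_fun, Fintype.card_bool, Fintype.card_fin]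
      ring
  have hsum : ∀ G : (Fin (a + 2) → Bool) → ℝ,
      ∑ y, G y = ∑ x₁ : Fin a → Bool, ∑ st : Bool × Bool, G (corner x₁ st) := by
    intro G
    rw [← Fintype.sum_prod_type']
    exact (Fintype.sum_bijective _ hbij (fun p => G (corner p.1 p.2)) G fun p => rfl).symm
  rw [hsum]
  -- evaluate each corner term
  have hterm : ∀ (x₁ : Fin a → Bool) (st : Bool × Bool),
      signOf (h (corner x₁ st)) *
          ∑ x₂ : Fin (a + 2) → Bool, signOf (f (Fin.append (φ (corner x₁ st)) x₂)) * twist x₂ (corner x₁ st) =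
        (2 : ℝ) ^ (a + 2) / 2 * signOf (h (corner x₁ st) ^^ f₀ x₁ ^^ (st.1 && st.2)) := by
    intro x₁ st
    rw [hφ, hW]
    have b1 : corner x₁ st = w x₁ ↔ st = (false, false) := by
      rw [← corner_ff corner w u v hc x₁]; exact (hinj x₁).eq_iff
    have b2 : corner x₁ st = bxor (w x₁) (u x₁) ↔ st = (true, false) := by
      rw [← corner_tf corner w u v hc x₁]; exact (hinj x₁).eq_iff
    have b3 : corner x₁ st = bxor (w x₁) (v x₁) ↔ st = (false, true) := by
      rw [← corner_ft corner w u v hc x₁]; exact (hinj x₁).eq_iff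
    have b4 : corner x₁ st = bxor (w x₁) (bxor (u x₁) (v x₁)) ↔ st = (true, true) := by
      rw [← corner_tt corner w u v hc x₁]; exact (hinj x₁).eq_iff
    simp only [b1, b2, b3, b4, signOf_xor]
    rcases st with ⟨σ, τ⟩
    cases σ <;> cases τ <;> simp [signOf]
  rw [sum_congr rfl fun x₁ _ => sum_congr rfl fun st _ => hterm x₁ st]
  simp only [← mul_sum]
  have h2 : (2 : ℝ) ^ (2 * a + 3) = (2 : ℝ) ^ (a + 2) / 2 * (2 : ℝ) ^ (a + 2) := by
    rw [show 2 * a + 3 = (a + 2) + (a + 1) from by ring, pow_add, pow_succ (2 : ℝ) (a + 1)]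
    ring
  rw [h2, mul_inv, mul_comm ((2 : ℝ) ^ (a + 2) / 2)⁻¹, mul_assoc, inv_mul_cancel_left₀ (by positivity)]

/-! ### The `15/16` ceiling for corner-flat pairs with a fibre of even parity -/

/-- One fibre: the four-corner sign sum is `≤ 4`, and `≤ 2` when the fibre parity is EVEN
(`false`): an even number of sign flips among the three corners `στ ≠ 11` and the flipped corner `στ = 11`
leaves at least one `−1`. -/
theorem cf_fibre_sum_le (h : (Fin (a + 2) → Bool) → Bool) (corner : (Fin a → Bool) → Bool × Bool → (Fin (a + 2) → Bool))
    (f₀ : (Fin a → Bool) → Bool) (x₁ : Fin a → Bool) :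
    ∑ st : Bool × Bool, signOf (h (corner x₁ st) ^^ f₀ x₁ ^^ (st.1 && st.2)) ≤
      if (h (corner x₁ (false, false)) ^^ h (corner x₁ (true, false)) ^^
        h (corner x₁ (false, true)) ^^ h (corner x₁ (true, true))) = false then 2 else 4 := by
  rw [Fintype.sum_prod_type]
  simp only [Fintype.sum_bool, Bool.true_and, Bool.false_and]
  cases h (corner x₁ (false, false)) <;> cases h (corner x₁ (true, false)) <;>
    cases h (corner x₁ (false, true)) <;> cases h (corner x₁ (true, true)) <;> cases f₀ x₁ <;>
    norm_num [signOf]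

/-- **`Φ ≤ 15/16` from one even fibre, parity form.**  In the corner-flat family, if the fibre-parity function
`x₁ ↦ ⊕_{στ} h(corner x₁ στ)` has degree `≤ 3` and ONE fibre has even parity, then `Φ(f,g) ≤ 15/16`: by the
Reed–Muller minimum weight (`stub_rmWeight`) at least `2^{a-3}` fibres are even, and an even fibre contributes
`≤ 2` instead of `4` to `2^{a+2}·Φ` (`cf_fibre_sum_le`).  The degree hypothesis is discharged by the parity lemmas
in the two corollaries below. [folklore] -/
theorem cf_forrelation_le_fifteen_sixteenths_of_parity (l : (Fin (a + 2) → Bool) → (Fin (a + 2) → Bool) → Bool)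
    (hl : ∀ y x, signOf (l y x) = twist x y)
    (u v w : (Fin a → Bool) → (Fin (a + 2) → Bool)) (f₀ : (Fin a → Bool) → Bool)
    (φ : (Fin (a + 2) → Bool) → (Fin a → Bool)) (h : (Fin (a + 2) → Bool) → Bool)
    (f g : (Fin (a + (a + 2)) → Bool) → Bool)
    (hf : ∀ x₁ x₂, f (Fin.append x₁ x₂) = ((l (u x₁) x₂ && l (v x₁) x₂) ^^ l (w x₁) x₂ ^^ f₀ x₁))
    (hg : ∀ (y₁ : Fin a → Bool) (y₂ : Fin (a + 2) → Bool),
      signOf (g (Fin.append y₁ y₂)) = twist y₁ (φ y₂) * signOf (h y₂))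
    (corner : (Fin a → Bool) → Bool × Bool → (Fin (a + 2) → Bool))
    (hc : ∀ x₁ st j, corner x₁ st j = (w x₁ j ^^ (st.1 && u x₁ j) ^^ (st.2 && v x₁ j)))
    (hφ : ∀ x₁ st, φ (corner x₁ st) = x₁) (hinj : ∀ x₁, Function.Injective (corner x₁))
    (hpar : IsDegLeFun 3 (fun x₁ => (h (corner x₁ (false, false)) ^^ h (corner x₁ (true, false)) ^^
        h (corner x₁ (false, true)) ^^ h (corner x₁ (true, true)))))
    (heven : ∃ x₁, (h (corner x₁ (false, false)) ^^ h (corner x₁ (true, false)) ^^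
      h (corner x₁ (false, true)) ^^ h (corner x₁ (true, true))) = false) :
    forrelation f g ≤ 15 / 16 := by
  classical
  obtain ⟨x₀, hx₀⟩ := heven
  have hEdeg : IsDegLeFun 3 (fun x₁ => !(h (corner x₁ (false, false)) ^^ h (corner x₁ (true, false)) ^^
        h (corner x₁ (false, true)) ^^ h (corner x₁ (true, true)))) :=
    rm_isDegLeFun_congr (fc_deg_bxor hpar (isDegLeFun_const 3 true)) fun x₁ => Bool.xor_true _
  have hcount : 2 ^ a ≤ 2 ^ 3 * (univ.filter fun x₁ : Fin a → Bool => (h (corner x₁ (false, false)) ^^ h (corner x₁ (true, false)) ^^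
        h (corner x₁ (false, true)) ^^ h (corner x₁ (true, true))) = false).card := by
    have hcnt := stub_rmWeight stub_derivDegree a 3 (fun x₁ => !(h (corner x₁ (false, false)) ^^ h (corner x₁ (true, false)) ^^
        h (corner x₁ (false, true)) ^^ h (corner x₁ (true, true)))) hEdeg ⟨x₀, by
        show (!(h (corner x₀ (false, false)) ^^ h (corner x₀ (true, false)) ^^
          h (corner x₀ (false, true)) ^^ h (corner x₀ (true, true)))) = true
        rw [hx₀]; rfl⟩
    simpa only [Bool.not_eq_true'] using hcnt
  have hcountR : (2 : ℝ) ^ a ≤ 8 *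
      ((univ.filter fun x₁ : Fin a → Bool => (h (corner x₁ (false, false)) ^^ h (corner x₁ (true, false)) ^^
        h (corner x₁ (false, true)) ^^ h (corner x₁ (true, true))) = false).card : ℝ) := by
    rw [← show (2 : ℝ) ^ 3 = 8 by norm_num]
    exact_mod_cast hcount
  have hcard : ((univ.filter fun x₁ : Fin a → Bool => (h (corner x₁ (false, false)) ^^ h (corner x₁ (true, false)) ^^
        h (corner x₁ (false, true)) ^^ h (corner x₁ (true, true))) = false).card : ℝ) +
      ((univ.filter fun x₁ : Fin a → Bool => ¬(h (corner x₁ (false, false)) ^^ h (corner x₁ (true, false)) ^^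
        h (corner x₁ (false, true)) ^^ h (corner x₁ (true, true))) = false).card : ℝ) = 2 ^ a := by
    rw [← Nat.cast_add, Finset.card_filter_add_card_filter_not, card_univ, Fintype.card_fun,
      Fintype.card_bool, Fintype.card_fin]
    push_cast
    ring
  have hS : ∑ x₁ : Fin a → Bool, ∑ st : Bool × Bool, signOf (h (corner x₁ st) ^^ f₀ x₁ ^^ (st.1 && st.2)) ≤
      2 * ((univ.filter fun x₁ : Fin a → Bool => (h (corner x₁ (false, false)) ^^ h (corner x₁ (true, false)) ^^
        h (corner x₁ (false, true)) ^^ h (corner x₁ (true, true))) = false).card : ℝ) +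
        4 * ((univ.filter fun x₁ : Fin a → Bool => ¬(h (corner x₁ (false, false)) ^^ h (corner x₁ (true, false)) ^^
        h (corner x₁ (false, true)) ^^ h (corner x₁ (true, true))) = false).card : ℝ) := by
    refine (sum_le_sum fun x₁ _ => cf_fibre_sum_le h corner f₀ x₁).trans (le_of_eq ?_)
    rw [Finset.sum_ite, sum_const, sum_const, nsmul_eq_mul, nsmul_eq_mul]
    ring
  rw [cf_forrelation_eq l hl u v w f₀ φ h f g hf hg corner hc hφ hinj]
  have hpos : (0 : ℝ) < 2 ^ (a + 2) := by positivity
  rw [inv_mul_le_iff₀ hpos, pow_succ, pow_succ]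
  linarith

/-- **Corner-flat pairs with a non-bent partner are `≤ 15/16`.**  In the corner-flat almost-Maiorana–McFarland
family of `cf_forrelation_eq` (cubic `h`, affine frame `u, v` with affine Plücker coordinates, coordinatewise
quadratic `w`), if SOME fibre has even parity `⊕_{στ} h(corner) = 0` — equivalently (`[cite: Carlet2020, §6.1]`,
not used here) the partner `g` is not bent — then `Φ(f,g) ≤ 15/16`: the parity function has degree `≤ 3`
(`cf_parity_deg`), so by the Reed–Muller minimum weight (stub B′) at least `2^{a-3}` fibres are even, each losing
`≥ 2` out of `4`.  Hence every member of this family in the window `(15/16, 1)` has a BENT partner `g`, which by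
the campaign's THEOREM BENT (bent-sided cubic pairs have `Φ = 1` or `Φ ≤ 15/16` at every even `n ≤ 20`) needs
`n = 2a + 2 ≥ 22`.  VALUE = THEOREM (a uniform ceiling for one syntactic family) — NOT summit progress. -/
theorem cf_forrelation_le_fifteen_sixteenths (l : (Fin (a + 2) → Bool) → (Fin (a + 2) → Bool) → Bool)
    (hl : ∀ y x, signOf (l y x) = twist x y)
    (u v w : (Fin a → Bool) → (Fin (a + 2) → Bool)) (f₀ : (Fin a → Bool) → Bool)
    (φ : (Fin (a + 2) → Bool) → (Fin a → Bool)) (h : (Fin (a + 2) → Bool) → Bool)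
    (f g : (Fin (a + (a + 2)) → Bool) → Bool)
    (hf : ∀ x₁ x₂, f (Fin.append x₁ x₂) = ((l (u x₁) x₂ && l (v x₁) x₂) ^^ l (w x₁) x₂ ^^ f₀ x₁))
    (hg : ∀ (y₁ : Fin a → Bool) (y₂ : Fin (a + 2) → Bool),
      signOf (g (Fin.append y₁ y₂)) = twist y₁ (φ y₂) * signOf (h y₂))
    (corner : (Fin a → Bool) → Bool × Bool → (Fin (a + 2) → Bool))
    (hc : ∀ x₁ st j, corner x₁ st j = (w x₁ j ^^ (st.1 && u x₁ j) ^^ (st.2 && v x₁ j)))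
    (hφ : ∀ x₁ st, φ (corner x₁ st) = x₁) (hinj : ∀ x₁, Function.Injective (corner x₁))
    (hh : IsDegLeFun 3 h)
    (hu : ∀ j, IsDegLeFun 1 (fun x₁ => u x₁ j)) (hv : ∀ j, IsDegLeFun 1 (fun x₁ => v x₁ j))
    (hw : ∀ j, IsDegLeFun 2 (fun x₁ => w x₁ j))
    (hwedge : ∀ i j, IsDegLeFun 1 (fun x₁ => (u x₁ i && v x₁ j) ^^ (u x₁ j && v x₁ i)))
    (heven : ∃ x₁, (h (corner x₁ (false, false)) ^^ h (corner x₁ (true, false)) ^^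
      h (corner x₁ (false, true)) ^^ h (corner x₁ (true, true))) = false) :
    forrelation f g ≤ 15 / 16 :=
  cf_forrelation_le_fifteen_sixteenths_of_parity l hl u v w f₀ φ h f g hf hg corner hc hφ hinj
    (rm_isDegLeFun_congr (cf_parity_deg hh hu hv hw hwedge) fun x₁ => (cf_corner_parity corner w u v hc x₁ h).symm)
    heven

/-- **`Φ ≤ 15/16` for corner-flat pairs with a non-bent partner — frame-free version.**  Same conclusion as
`cf_forrelation_le_fifteen_sixteenths`, but the degree hypotheses are only those FORCED by cubicity of `f`:
affine Plücker coordinates `x₁ ↦ uᵢvⱼ ⊕ uⱼvᵢ` (the `x₂`-quadratic ANF coefficients of `f`) and quadratic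
`x₁ ↦ wᵢ ⊕ uᵢvᵢ` (the `x₂`-linear ANF coefficients of `f`); the frame `u, v` and the base point `w` themselves are
arbitrary (via the frame-free parity lemma `cfp_parity_deg`).  So on the WHOLE corner-flat habitat a window value
`Φ ∈ (15/16, 1)` needs every fibre parity odd, i.e. a bent cubic partner `g`. [folklore] -/
theorem cf_forrelation_le_fifteen_sixteenths' (l : (Fin (a + 2) → Bool) → (Fin (a + 2) → Bool) → Bool)
    (hl : ∀ y x, signOf (l y x) = twist x y)
    (u v w : (Fin a → Bool) → (Fin (a + 2) → Bool)) (f₀ : (Fin a → Bool) → Bool)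
    (φ : (Fin (a + 2) → Bool) → (Fin a → Bool)) (h : (Fin (a + 2) → Bool) → Bool)
    (f g : (Fin (a + (a + 2)) → Bool) → Bool)
    (hf : ∀ x₁ x₂, f (Fin.append x₁ x₂) = ((l (u x₁) x₂ && l (v x₁) x₂) ^^ l (w x₁) x₂ ^^ f₀ x₁))
    (hg : ∀ (y₁ : Fin a → Bool) (y₂ : Fin (a + 2) → Bool),
      signOf (g (Fin.append y₁ y₂)) = twist y₁ (φ y₂) * signOf (h y₂))
    (corner : (Fin a → Bool) → Bool × Bool → (Fin (a + 2) → Bool))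
    (hc : ∀ x₁ st j, corner x₁ st j = (w x₁ j ^^ (st.1 && u x₁ j) ^^ (st.2 && v x₁ j)))
    (hφ : ∀ x₁ st, φ (corner x₁ st) = x₁) (hinj : ∀ x₁, Function.Injective (corner x₁))
    (hh : IsDegLeFun 3 h)
    (hwedge : ∀ i j, IsDegLeFun 1 (fun x₁ => (u x₁ i && v x₁ j) ^^ (u x₁ j && v x₁ i)))
    (hlin : ∀ j, IsDegLeFun 2 (fun x₁ => w x₁ j ^^ (u x₁ j && v x₁ j)))
    (heven : ∃ x₁, (h (corner x₁ (false, false)) ^^ h (corner x₁ (true, false)) ^^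
      h (corner x₁ (false, true)) ^^ h (corner x₁ (true, true))) = false) :
    forrelation f g ≤ 15 / 16 :=
  cf_forrelation_le_fifteen_sixteenths_of_parity l hl u v w f₀ φ h f g hf hg corner hc hφ hinj
    (rm_isDegLeFun_congr (cfp_parity_deg hh hwedge hlin) fun x₁ => (cf_corner_parity corner w u v hc x₁ h).symm)
    heven

/-! ### The degree hypotheses follow from cubicity of `f` -/

/-- Boolean values of a dot-product function `l` (`(-1)^{l y x} = (-1)^{x·y}`): `l y 0 = 0`, `l y eᵢ = yᵢ`,
`l y (eᵢ ⊕ eⱼ) = yᵢ ⊕ yⱼ`. [folklore] -/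
theorem cf_l_values (l : (Fin (a + 2) → Bool) → (Fin (a + 2) → Bool) → Bool) (hl : ∀ y x, signOf (l y x) = twist x y)
    (y : Fin (a + 2) → Bool) (i j : Fin (a + 2)) :
    l y zeroVec = false ∧ l y (Pi.single i true) = y i ∧
      l y (bxor (Pi.single i true) (Pi.single j true)) = (y i ^^ y j) := by
  refine ⟨acq_signOf_inj _ _ ?_, acq_signOf_inj _ _ ?_, acq_signOf_inj _ _ ?_⟩
  · rw [hl, twist_comm, twist_zeroVec_right]
    simp [signOf]
  · rw [hl, fc_twist_single]
  · rw [hl, twist_comm, twist_bxor_right, twist_comm y, twist_comm y, fc_twist_single, fc_twist_single, signOf_xor]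

/-- In the corner-flat family, cubicity of `f` gives the two degree hypotheses of the frame-free parity lemma:
the Plücker coordinates `x₁ ↦ uᵢvⱼ ⊕ uⱼvᵢ = f(x₁‖0) ⊕ f(x₁‖eᵢ) ⊕ f(x₁‖eⱼ) ⊕ f(x₁‖eᵢ⊕eⱼ)` are affine
(`acx_deg_polar`) and `x₁ ↦ wⱼ ⊕ uⱼvⱼ = f(x₁‖eⱼ) ⊕ f(x₁‖0)` is quadratic (`acx_deg_first`). [cite: Carlet2020, §2.2] -/
theorem cf_degrees_of_cubic (l : (Fin (a + 2) → Bool) → (Fin (a + 2) → Bool) → Bool)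
    (hl : ∀ y x, signOf (l y x) = twist x y) (u v w : (Fin a → Bool) → (Fin (a + 2) → Bool))
    (f₀ : (Fin a → Bool) → Bool) (f : (Fin (a + (a + 2)) → Bool) → Bool)
    (hf : ∀ x₁ x₂, f (Fin.append x₁ x₂) = ((l (u x₁) x₂ && l (v x₁) x₂) ^^ l (w x₁) x₂ ^^ f₀ x₁))
    (hfc : IsDegLeFun 3 f) :
    (∀ i j, IsDegLeFun 1 (fun x₁ => (u x₁ i && v x₁ j) ^^ (u x₁ j && v x₁ i))) ∧
      ∀ j, IsDegLeFun 2 (fun x₁ => w x₁ j ^^ (u x₁ j && v x₁ j)) := by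
  have hl0 : ∀ y, l y zeroVec = false := fun y => (cf_l_values l hl y 0 0).1
  have hl1 : ∀ y i, l y (Pi.single i true) = y i := fun y i => (cf_l_values l hl y i i).2.1
  have hl2 : ∀ y i j, l y (bxor (Pi.single i true) (Pi.single j true)) = (y i ^^ y j) :=
    fun y i j => (cf_l_values l hl y i j).2.2
  refine ⟨fun i j => rm_isDegLeFun_congr (acx_deg_polar hfc (Pi.single i true) (Pi.single j true)) fun x₁ => ?_,
    fun j => rm_isDegLeFun_congr (acx_deg_first hfc (Pi.single j true)) fun x₁ => ?_⟩
  · rw [hf, hf, hf, hf]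
    simp only [hl0, hl1, hl2]
    cases u x₁ i <;> cases u x₁ j <;> cases v x₁ i <;> cases v x₁ j <;> cases w x₁ i <;> cases w x₁ j <;>
      cases f₀ x₁ <;> rfl
  · rw [hf, hf]
    simp only [hl0, hl1]
    cases u x₁ j <;> cases v x₁ j <;> cases w x₁ j <;> cases f₀ x₁ <;> rfl

/-- **`Φ ≤ 15/16` for corner-flat pairs with a non-bent partner — cubic form.**  The cleanest statement: in the
corner-flat family (`hf`, `hg`, corners in their fibres and distinct), if `f` and `h` are CUBIC and one fibre has
even `h`-parity, then `Φ(f,g) ≤ 15/16`; equivalently a window value `Φ ∈ (15/16, 1)` forces every fibre parity odd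
(`g` bent).  (`cf_degrees_of_cubic` + `cf_forrelation_le_fifteen_sixteenths'`.) [folklore] -/
theorem cf_forrelation_le_fifteen_sixteenths_of_cubic (l : (Fin (a + 2) → Bool) → (Fin (a + 2) → Bool) → Bool)
    (hl : ∀ y x, signOf (l y x) = twist x y)
    (u v w : (Fin a → Bool) → (Fin (a + 2) → Bool)) (f₀ : (Fin a → Bool) → Bool)
    (φ : (Fin (a + 2) → Bool) → (Fin a → Bool)) (h : (Fin (a + 2) → Bool) → Bool)
    (f g : (Fin (a + (a + 2)) → Bool) → Bool)
    (hf : ∀ x₁ x₂, f (Fin.append x₁ x₂) = ((l (u x₁) x₂ && l (v x₁) x₂) ^^ l (w x₁) x₂ ^^ f₀ x₁))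
    (hg : ∀ (y₁ : Fin a → Bool) (y₂ : Fin (a + 2) → Bool),
      signOf (g (Fin.append y₁ y₂)) = twist y₁ (φ y₂) * signOf (h y₂))
    (corner : (Fin a → Bool) → Bool × Bool → (Fin (a + 2) → Bool))
    (hc : ∀ x₁ st j, corner x₁ st j = (w x₁ j ^^ (st.1 && u x₁ j) ^^ (st.2 && v x₁ j)))
    (hφ : ∀ x₁ st, φ (corner x₁ st) = x₁) (hinj : ∀ x₁, Function.Injective (corner x₁))
    (hfc : IsDegLeFun 3 f) (hh : IsDegLeFun 3 h)
    (heven : ∃ x₁, (h (corner x₁ (false, false)) ^^ h (corner x₁ (true, false)) ^^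
      h (corner x₁ (false, true)) ^^ h (corner x₁ (true, true))) = false) :
    forrelation f g ≤ 15 / 16 :=
  cf_forrelation_le_fifteen_sixteenths' l hl u v w f₀ φ h f g hf hg corner hc hφ hinj hh
    (cf_degrees_of_cubic l hl u v w f₀ f hf hfc).1 (cf_degrees_of_cubic l hl u v w f₀ f hf hfc).2 heven

/-- Contrapositive, for planners: a corner-flat pair with cubic `f`, `h` and `Φ(f,g) > 15/16` has all fibre
parities odd (every fibre of `φ` carries an odd number of ones of `h` — `g` is bent). [folklore] -/
theorem cf_window_fibres_odd (l : (Fin (a + 2) → Bool) → (Fin (a + 2) → Bool) → Bool)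
    (hl : ∀ y x, signOf (l y x) = twist x y)
    (u v w : (Fin a → Bool) → (Fin (a + 2) → Bool)) (f₀ : (Fin a → Bool) → Bool)
    (φ : (Fin (a + 2) → Bool) → (Fin a → Bool)) (h : (Fin (a + 2) → Bool) → Bool)
    (f g : (Fin (a + (a + 2)) → Bool) → Bool)
    (hf : ∀ x₁ x₂, f (Fin.append x₁ x₂) = ((l (u x₁) x₂ && l (v x₁) x₂) ^^ l (w x₁) x₂ ^^ f₀ x₁))
    (hg : ∀ (y₁ : Fin a → Bool) (y₂ : Fin (a + 2) → Bool),
      signOf (g (Fin.append y₁ y₂)) = twist y₁ (φ y₂) * signOf (h y₂))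
    (corner : (Fin a → Bool) → Bool × Bool → (Fin (a + 2) → Bool))
    (hc : ∀ x₁ st j, corner x₁ st j = (w x₁ j ^^ (st.1 && u x₁ j) ^^ (st.2 && v x₁ j)))
    (hφ : ∀ x₁ st, φ (corner x₁ st) = x₁) (hinj : ∀ x₁, Function.Injective (corner x₁))
    (hfc : IsDegLeFun 3 f) (hh : IsDegLeFun 3 h) (hwin : 15 / 16 < forrelation f g) (x₁ : Fin a → Bool) :
    (h (corner x₁ (false, false)) ^^ h (corner x₁ (true, false)) ^^
      h (corner x₁ (false, true)) ^^ h (corner x₁ (true, true))) = true := by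
  by_contra hne
  exact absurd hwin (not_lt.mpr (cf_forrelation_le_fifteen_sixteenths_of_cubic l hl u v w f₀ φ h f g hf hg corner
    hc hφ hinj hfc hh ⟨x₁, Bool.eq_false_iff.mpr hne⟩))

end Summit.QuantumAdvantage.QuantumAdvantage.Theorems.NearExactIsExact.Negative.CornerFlatParity

end
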